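import Summits.ValiantsHypothesis.ValiantsHypothesis.Theorems.RigidityForcesSymmetryGrenetFirstOrderRankRigidBlockIIMaster
import Summits.ValiantsHypothesis.ValiantsHypothesis.Theorems.RigidityForcesSymmetryGrenetFirstOrderRankRigidBlockIIPermEval

/-!
# Route RigidityForcesSymmetry — `GrenetFirstOrderRankRigid` (item stmt-ValiantsHypothesis-21029),
line `grenet_gauge`: stub `stub_linearRigid`, step 5 (block II) — design E1

For the crux line `Cruxes/GrenetFirstOrderRankRigid/Lines/grenet_gauge.lean` (blueprint
`Lines/grenet_gauge-stub_linearRigid-PROOF.md`, §5, block II; NOTES "TYPE II FORMAL PLAN").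
Design E1 of the overlap block `(A, k₀)`: at the permutation point of a `π` with `π({c < k₀}) = C₀ ⊆ Aᶜ`,
`π({k₀ ≤ c < u}) = A` (`α_first = π(k₀)`, `α_last = π(u-1)`) the master identity of the block
(`grenet_blockII_master`) becomes
`Σ_{C' ≠ C₀} ρ[C', α_last] + Σ_{C' ≠ C₀} κ[C', α_first] = 0`
(`grenet_blockII_E1`, the sums written over the tail-shaped / head-shaped entries).  No new
definitions.  VP ≠ VNP is not moved by this file.
-/

noncomputable section

open MvPolynomial Matrix Finset

namespace Summit.ValiantsHypothesis.Theorems.RigidityForcesSymmetry.GrenetGauge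

open Literature.Computability.AlgebraicComplexity

variable {k : Type*} [CommRing k] [IsDomain k] {n N : ℕ} (e : Finset (Fin n) ≃ Fin (N + 1))

/-- **Design E1 of the overlap block `(A, k₀)`.**  At the permutation point of `π`
(`π({c < k₀}) = C₀ ⊆ Aᶜ`, `π({k₀ ≤ c < u}) = A`), the block identity of a tangent direction supported
on the tail/head positions reads `Σ_{C' ≠ C₀} ρ[C', π(u-1)] + Σ_{C' ≠ C₀} κ[C', π(k₀)] = 0`.
[cite: Grenet2011, Thm. 1] -/
theorem grenet_blockII_E1 (hn : n ≠ 0) (hN : 2 ^ n = N + 1)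
    (A' : Fin n × Fin n → Matrix (Fin N) (Fin N) k)
    (htr : ((Grenet.repr k n e).adjugate * ∑ v, (X v : MvPolynomial (Fin n × Fin n) k) • (A' v).map C).trace = 0)
    (hsupp : ∀ (w : Fin n × Fin n) (a b : Fin N), A' w a b ≠ 0 →
      (w.1 ∉ e.symm ((e univ).succAbove a) ∧ (w.2 : ℕ) = (e.symm ((e univ).succAbove a)).card) ∨
      (w.1 ∈ e.symm ((e ∅).succAbove b) ∧ (e.symm ((e ∅).succAbove b)).card = (w.2 : ℕ) + 1))
    (A : Finset (Fin n)) (hA : 0 < A.card) (k₀ : ℕ) {u : ℕ} (huA : A.card + k₀ = u) (hu : u ≤ n)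
    (hul : u - 1 < n) (hkn : k₀ < n) (π : Equiv.Perm (Fin n))
    (hπC : (univ.filter fun c : Fin n => (c : ℕ) < k₀).image π ⊆ Aᶜ)
    (hπA : (univ.filter fun c : Fin n => k₀ ≤ (c : ℕ) ∧ (c : ℕ) < u).image π = A) :
    ∑ x ∈ univ.filter (fun x : Fin N × Fin N × (Fin n × Fin n) => (x.2.2.1 ∉ e.symm ((e univ).succAbove x.1) ∧ e.symm ((e ∅).succAbove x.2.1) ⊆ Aᶜ ∧
        (e.symm ((e ∅).succAbove x.2.1)).card = k₀ ∧
        insert x.2.2.1 (e.symm ((e univ).succAbove x.1)) = A ∪ e.symm ((e ∅).succAbove x.2.1) ∧ (x.2.2.2 : ℕ) = u - 1) ∧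
        (x.2.2.1 = π ⟨u - 1, hul⟩ ∧ e.symm ((e ∅).succAbove x.2.1) ≠ (univ.filter fun c : Fin n => (c : ℕ) < k₀).image π)),
        A' x.2.2 x.1 x.2.1
      + ∑ x ∈ univ.filter (fun x : Fin N × Fin N × (Fin n × Fin n) => (x.2.2.1 ∈ e.symm ((e ∅).succAbove x.2.1) ∧ (e.symm ((e ∅).succAbove x.2.1)).erase x.2.2.1 ⊆ Aᶜ ∧
        ((e.symm ((e ∅).succAbove x.2.1)).erase x.2.2.1).card = k₀ ∧
        e.symm ((e univ).succAbove x.1) = A ∪ (e.symm ((e ∅).succAbove x.2.1)).erase x.2.2.1 ∧ (x.2.2.2 : ℕ) = k₀) ∧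
        (x.2.2.1 = π ⟨k₀, hkn⟩ ∧ (e.symm ((e ∅).succAbove x.2.1)).erase x.2.2.1 ≠ (univ.filter fun c : Fin n => (c : ℕ) < k₀).image π)),
        A' x.2.2 x.1 x.2.1 = 0 := by
  classical
  have hm := grenet_blockII_master e hn hN A' htr hsupp A hA k₀ huA hu
    (fun w : Fin n × Fin n => if π w.2 = w.1 then (1 : k) else 0)
  have e1 : ∑ x ∈ univ.filter (fun x : Fin N × Fin N × (Fin n × Fin n) => (x.2.2.1 ∉ e.symm ((e univ).succAbove x.1) ∧ e.symm ((e ∅).succAbove x.2.1) ⊆ Aᶜ ∧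
        (e.symm ((e ∅).succAbove x.2.1)).card = k₀ ∧
        insert x.2.2.1 (e.symm ((e univ).succAbove x.1)) = A ∪ e.symm ((e ∅).succAbove x.2.1) ∧ (x.2.2.2 : ℕ) = u - 1)),
      A' x.2.2 x.1 x.2.1 * eval (fun w : Fin n × Fin n => if π w.2 = w.1 then (1 : k) else 0) (perPoly (Fin n) k * (1 - Grenet.adj k n).adjugate (e.symm ((e ∅).succAbove x.2.1)) (e.symm ((e univ).succAbove x.1)) * X x.2.2
          - (1 - Grenet.adj k n).adjugate ∅ (e.symm ((e univ).succAbove x.1)) * X x.2.2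
            * (1 - Grenet.adj k n).adjugate (e.symm ((e ∅).succAbove x.2.1)) univ)
      = ∑ x ∈ univ.filter (fun x : Fin N × Fin N × (Fin n × Fin n) => (x.2.2.1 ∉ e.symm ((e univ).succAbove x.1) ∧ e.symm ((e ∅).succAbove x.2.1) ⊆ Aᶜ ∧
        (e.symm ((e ∅).succAbove x.2.1)).card = k₀ ∧
        insert x.2.2.1 (e.symm ((e univ).succAbove x.1)) = A ∪ e.symm ((e ∅).succAbove x.2.1) ∧ (x.2.2.2 : ℕ) = u - 1)),
        if (x.2.2.1 = π ⟨u - 1, hul⟩ ∧ e.symm ((e ∅).succAbove x.2.1) ≠ (univ.filter fun c : Fin n => (c : ℕ) < k₀).image π)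
        then A' x.2.2 x.1 x.2.1 else 0 := by
    refine Finset.sum_congr rfl fun x hx => ?_
    obtain ⟨h1, h2, h3, h4, h5⟩ := (Finset.mem_filter.mp hx).2
    have hdisj : Disjoint A (e.symm ((e ∅).succAbove x.2.1)) :=
      Finset.disjoint_left.mpr fun y hyA hyC => (Finset.mem_compl.mp (h2 hyC)) hyA
    have hScard : (e.symm ((e univ).succAbove x.1)).card = u - 1 := by
      have := congrArg Finset.card h4
      rw [Finset.card_insert_of_notMem h1, Finset.card_union_of_disjoint hdisj, h3] at this; omega
    rw [blockII_perm_eval_tail k π A hA k₀ huA hu hul hkn hπC hπA (e.symm ((e univ).succAbove x.1)) (e.symm ((e ∅).succAbove x.2.1)) x.2.2 ⟨h1, by omega⟩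
      h2 h3 h4 h5]
    by_cases g1 : x.2.2.1 = π ⟨u - 1, hul⟩ <;>
      by_cases g2 : e.symm ((e ∅).succAbove x.2.1) = (univ.filter fun c : Fin n => (c : ℕ) < k₀).image π <;> simp [g1, g2]
  have e2 : ∑ x ∈ univ.filter (fun x : Fin N × Fin N × (Fin n × Fin n) => (x.2.2.1 ∈ e.symm ((e ∅).succAbove x.2.1) ∧ (e.symm ((e ∅).succAbove x.2.1)).erase x.2.2.1 ⊆ Aᶜ ∧
        ((e.symm ((e ∅).succAbove x.2.1)).erase x.2.2.1).card = k₀ ∧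
        e.symm ((e univ).succAbove x.1) = A ∪ (e.symm ((e ∅).succAbove x.2.1)).erase x.2.2.1 ∧ (x.2.2.2 : ℕ) = k₀)),
      A' x.2.2 x.1 x.2.1 * eval (fun w : Fin n × Fin n => if π w.2 = w.1 then (1 : k) else 0) (perPoly (Fin n) k * (1 - Grenet.adj k n).adjugate (e.symm ((e ∅).succAbove x.2.1)) (e.symm ((e univ).succAbove x.1)) * X x.2.2
          - (1 - Grenet.adj k n).adjugate ∅ (e.symm ((e univ).succAbove x.1)) * X x.2.2
            * (1 - Grenet.adj k n).adjugate (e.symm ((e ∅).succAbove x.2.1)) univ)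
      = ∑ x ∈ univ.filter (fun x : Fin N × Fin N × (Fin n × Fin n) => (x.2.2.1 ∈ e.symm ((e ∅).succAbove x.2.1) ∧ (e.symm ((e ∅).succAbove x.2.1)).erase x.2.2.1 ⊆ Aᶜ ∧
        ((e.symm ((e ∅).succAbove x.2.1)).erase x.2.2.1).card = k₀ ∧
        e.symm ((e univ).succAbove x.1) = A ∪ (e.symm ((e ∅).succAbove x.2.1)).erase x.2.2.1 ∧ (x.2.2.2 : ℕ) = k₀)),
        if (x.2.2.1 = π ⟨k₀, hkn⟩ ∧ (e.symm ((e ∅).succAbove x.2.1)).erase x.2.2.1 ≠ (univ.filter fun c : Fin n => (c : ℕ) < k₀).image π)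
        then A' x.2.2 x.1 x.2.1 else 0 := by
    refine Finset.sum_congr rfl fun x hx => ?_
    obtain ⟨h1, h2, h3, h4, h5⟩ := (Finset.mem_filter.mp hx).2
    have hTcard : (e.symm ((e ∅).succAbove x.2.1)).card = (x.2.2.2 : ℕ) + 1 := by
      have := Finset.card_erase_of_mem h1
      have h' := Finset.card_pos.mpr ⟨_, h1⟩
      rw [h3] at this; omega
    rw [blockII_perm_eval_head k π A hA k₀ huA hu hul hkn hπC hπA (e.symm ((e univ).succAbove x.1)) (e.symm ((e ∅).succAbove x.2.1)) x.2.2 ⟨h1, hTcard⟩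
      h2 h3 h4 h5]
    by_cases g1 : x.2.2.1 = π ⟨k₀, hkn⟩
    · by_cases g2 : (e.symm ((e ∅).succAbove x.2.1)).erase x.2.2.1 = (univ.filter fun c : Fin n => (c : ℕ) < k₀).image π
      · rw [if_pos g1, if_pos (show x.2.2.1 = π ⟨k₀, hkn⟩ ∧ (e.symm ((e ∅).succAbove x.2.1)).erase x.2.2.1 =
            (univ.filter fun c : Fin n => (c : ℕ) < k₀).image π from ⟨g1, g2⟩),
          if_neg (show ¬ (x.2.2.1 = π ⟨k₀, hkn⟩ ∧ (e.symm ((e ∅).succAbove x.2.1)).erase x.2.2.1 ≠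
            (univ.filter fun c : Fin n => (c : ℕ) < k₀).image π) from fun h => h.2 g2)]
        ring
      · rw [if_pos g1, if_neg (show ¬ (x.2.2.1 = π ⟨k₀, hkn⟩ ∧ (e.symm ((e ∅).succAbove x.2.1)).erase x.2.2.1 =
            (univ.filter fun c : Fin n => (c : ℕ) < k₀).image π) from fun h => g2 h.2),
          if_pos (show (x.2.2.1 = π ⟨k₀, hkn⟩ ∧ (e.symm ((e ∅).succAbove x.2.1)).erase x.2.2.1 ≠
            (univ.filter fun c : Fin n => (c : ℕ) < k₀).image π) from ⟨g1, g2⟩)]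
        ring
    · rw [if_neg g1, if_neg (show ¬ (x.2.2.1 = π ⟨k₀, hkn⟩ ∧ (e.symm ((e ∅).succAbove x.2.1)).erase x.2.2.1 =
            (univ.filter fun c : Fin n => (c : ℕ) < k₀).image π) from fun h => g1 h.1),
          if_neg (show ¬ (x.2.2.1 = π ⟨k₀, hkn⟩ ∧ (e.symm ((e ∅).succAbove x.2.1)).erase x.2.2.1 ≠
            (univ.filter fun c : Fin n => (c : ℕ) < k₀).image π) from fun h => g1 h.1)]
      ring
  rw [e1, e2, ← Finset.sum_filter, ← Finset.sum_filter, Finset.filter_filter, Finset.filter_filter] at hm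
  exact hm

end Summit.ValiantsHypothesis.Theorems.RigidityForcesSymmetry.GrenetGauge
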